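import Summits.Ventures.LatticeQCDFlow.Scoring.SU2TorusPolyakovLoops
import HarnessLib

/-!
# SU(2) on the 2-torus: THE EXACT MEAN SQUARE OF THE POLYAKOV LOOP `⟨(½ tr P_j)²⟩_{(ℤ/L)², β}`

HONEST FRAMING: exact (Metropolis-corrected) sampling algorithms for lattice gauge theory;
figures of merit are autocorrelation/cost numbers at stated couplings and volumes; no
continuum-physics claim.

Venture `LatticeQCDFlow` (cell pub-lqcd), sub-topic `Scoring`; FANOUT row 5 (`s0-sun-a`), GEN-11.
NEW WORK of the cell (placement rule); the coincident case `R = 0` of oracle X02's `polyakov_2pt`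
(`⟨|l|²⟩`), completing `SU2TorusPolyakovLoops` (separations `1 ≤ R ≤ L−1`).  `P_j = h(i,j)⋯h(i+L−1,j)` is the
Polyakov line through `(i,j)`, `c_n(β) = e^{−2β}(I_n(2β) − I_{n+2}(2β))`, `λ_n = c_n/(n+1)`.

* `integral_su2a0_sq_mul_su2Character_sq` — `∫ a₀² χ_μ² dHaar = ¼(1 + [μ ≠ 0])`;
* `integral_su2a0_sq_polyakov_mul_prod_su2Character` — the torus cut along `P_j` merges to
  `χ_μ(P_j)²/(μ+1)^{L²}` (`SU2TorusAnnulusMerging` with `T = L`), whence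
  `∫ a₀(P_j)²·∏_x χ_{m_x}(U_x) dHaar^{⊗E} = [m ≡ μ]·((μ+1)^{L²})⁻¹·¼(1 + [μ ≠ 0])`;
* **`wilson_mean_su2a0_sq_polyakov_two`** — for every `L ≥ 1`, `β ≥ 0`:
  `⟨(½ tr P_j)²⟩_{(ℤ/L)²,β} = ¼ Σ_n (1 + [n ≠ 0]) λ_n^{L²} / Σ_n λ_n^{L²}` (`= ½ − λ_0^{L²}/(4Z)`, just above
  `¼` at the cell's volumes; X02 `L = 4`, `b = 2.2`: `0.2500012`, T5 Metropolis `0.24997(21)`).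

Nothing is cited; no `def`.
-/

noncomputable section

open Real MeasureTheory Set Function Finset Polynomial.Chebyshev
open Literature.MathematicalPhysics.QuantumFieldTheory Literature.MathematicalPhysics.QuantumLattice
open Literature.Analysis.FunctionSpaces
open Summit.Ventures.LatticeQCDFlow.Exactness
open Summit.Ventures.LatticeQCDFlow.Theory2.Lattice

namespace Summit.Ventures.LatticeQCDFlow.Scoring

/-! ## §1. `∫ a₀² χ_μ² dHaar` -/

/-- **`∫ a₀²·χ_μ² dHaar = ¼·(1 + [μ ≠ 0])`** on `SU(2)`: `a₀χ_μ = ½(χ_{μ+1} + χ_{μ−1})` twice and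
orthonormality. -/
theorem integral_su2a0_sq_mul_su2Character_sq (μ : ℕ) :
    ∫ g, su2a0 g * su2a0 g * ((U ℝ μ).eval (su2a0 g) * (U ℝ μ).eval (su2a0 g))
        ∂(haarProbability (Matrix.specialUnitaryGroup (Fin 2) ℂ)) =
      (1 / 4) * (if μ = 0 then 1 else 2) := by
  haveI := secondCountableTopology_su2
  have hi : ∀ p q : ℕ, Integrable (fun g : Matrix.specialUnitaryGroup (Fin 2) ℂ =>
      su2a0 g * (U ℝ p).eval (su2a0 g) * (U ℝ q).eval (su2a0 g))
      (haarProbability (Matrix.specialUnitaryGroup (Fin 2) ℂ)) := fun p q =>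
    integrable_of_continuous_compactSpace
      ((continuous_su2a0.mul (continuous_su2Character_comp p continuous_id)).mul
        (continuous_su2Character_comp q continuous_id))
  rcases Nat.eq_zero_or_pos μ with rfl | hμ
  · have hpt : ∀ g : Matrix.specialUnitaryGroup (Fin 2) ℂ,
        su2a0 g * su2a0 g * ((U ℝ (0 : ℕ)).eval (su2a0 g) * (U ℝ (0 : ℕ)).eval (su2a0 g)) =
        (1 / 2) * (su2a0 g * (U ℝ (0 : ℕ)).eval (su2a0 g) * (U ℝ (0 + 1 : ℕ)).eval (su2a0 g)) := by
      intro g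
      have h := mul_chebyshevU_eval ((0 : ℕ) : ℤ) (su2a0 g)
      push_cast at h
      simp only [U_neg_one, Polynomial.eval_zero, add_zero] at h
      push_cast
      linear_combination (su2a0 g * (U ℝ 0).eval (su2a0 g)) * h
    simp_rw [hpt]
    rw [integral_const_mul, integral_su2a0_mul_su2Character_mul_su2Character]
    norm_num
  · obtain ⟨k, rfl⟩ : ∃ k, μ = k + 1 := ⟨μ - 1, by omega⟩
    have hpt : ∀ g : Matrix.specialUnitaryGroup (Fin 2) ℂ,
        su2a0 g * su2a0 g * ((U ℝ (k + 1 : ℕ)).eval (su2a0 g) * (U ℝ (k + 1 : ℕ)).eval (su2a0 g)) =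
        (1 / 2) * (su2a0 g * (U ℝ (k + 1 : ℕ)).eval (su2a0 g) * (U ℝ (k + 1 + 1 : ℕ)).eval (su2a0 g)) +
          (1 / 2) * (su2a0 g * (U ℝ (k + 1 : ℕ)).eval (su2a0 g) * (U ℝ k).eval (su2a0 g)) := by
      intro g
      have h := mul_chebyshevU_eval ((k + 1 : ℕ) : ℤ) (su2a0 g)
      push_cast at h
      rw [add_sub_cancel_right] at h
      push_cast
      linear_combination (su2a0 g * (U ℝ ((k : ℤ) + 1)).eval (su2a0 g)) * h
    simp_rw [hpt]
    rw [integral_add ((hi _ _).const_mul _) ((hi _ _).const_mul _), integral_const_mul, integral_const_mul,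
      integral_su2a0_mul_su2Character_mul_su2Character, integral_su2a0_mul_su2Character_mul_su2Character,
      if_neg (Nat.succ_ne_zero k), if_neg (Nat.succ_ne_zero k), Nat.add_sub_cancel]
    have h1 : ¬ (k = k + 1 + 1) := by omega
    have h2 : ¬ (k + 1 + 1 = k) := by omega
    simp [h1, h2]
    norm_num

variable {L : ℕ} [NeZero L]

/-! ## §2. The inserted character integral -/

/-- **THE CHARACTER INTEGRAL WITH THE SQUARE OF A POLYAKOV LINE INSERTED**: for every `m : Λ → ℕ`,
`∫ a₀(P_j)²·∏_x χ_{m_x}(U_x) dHaar^{⊗E} = [∀ a b, m(i+a,j+b) = m(i,j)]·((m(i,j)+1)^{L·L})⁻¹·¼(1 + [m(i,j) ≠ 0])`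
— the torus cut along `P_j` merges to `χ(P_j)²` (`integral_mul_prod_annulus_su2Character`, `T = L`). -/
theorem integral_su2a0_sq_polyakov_mul_prod_su2Character (i j : ZMod L) (m : Site 2 L → ℕ) :
    ∫ V, su2a0 (((List.range L).map fun a : ℕ => V (![i + a, j], 0)).prod) *
          su2a0 (((List.range L).map fun a : ℕ => V (![i + a, j], 0)).prod) *
        ∏ x : Site 2 L, (U ℝ (m x)).eval (su2a0 (plaquetteHolonomy V x 0 1))
        ∂(Measure.pi fun _ : Edge 2 L => haarProbability (Matrix.specialUnitaryGroup (Fin 2) ℂ)) =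
      if (∀ a < L, ∀ b < L, m ![i + a, j + b] = m ![i, j]) then
        ((((m ![i, j] : ℝ) + 1) ^ (L * L)))⁻¹ * ((1 / 4) * (if m ![i, j] = 0 then 1 else 2))
      else 0 := by
  have hL : 1 ≤ L := Nat.one_le_iff_ne_zero.mpr (NeZero.ne L)
  have hsplit : ∀ V : GaugeConfig 2 L (Matrix.specialUnitaryGroup (Fin 2) ℂ),
      ∏ x : Site 2 L, (U ℝ (m x)).eval (su2a0 (plaquetteHolonomy V x 0 1)) =
      ∏ b ∈ range L, ∏ a ∈ range L,
        (U ℝ (m ![i + a, j + b])).eval (su2a0 (plaquetteHolonomy V ![i + a, j + b] 0 1)) := by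
    intro V
    have h := prod_rect_eq i j le_rfl le_rfl (fun x => (U ℝ (m x)).eval (su2a0 (plaquetteHolonomy V x 0 1)))
    rw [rect_eq_univ] at h
    exact h
  simp_rw [hsplit]
  have hPc := continuous_rowProd (L := L) i j L
  rw [integral_mul_prod_annulus_su2Character i j m hL le_rfl
    (fun V => su2a0 (((List.range L).map fun a : ℕ => V (![i + a, j], 0)).prod) *
      su2a0 (((List.range L).map fun a : ℕ => V (![i + a, j], 0)).prod))
    ((continuous_su2a0.comp hPc).mul (continuous_su2a0.comp hPc))
    (fun a b _ _ V g => by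
      show su2a0 _ * su2a0 _ = su2a0 _ * su2a0 _
      rw [rowProd_update_of_ne i j V _ g (Or.inl rfl) L])
    (fun b hb0 hbL V g => by
      show su2a0 _ * su2a0 _ = su2a0 _ * su2a0 _
      rw [rowProd_update_of_ne i j V _ g (Or.inr ?_) L]
      intro h
      change j + (b : ZMod L) = j at h
      exact absurd (Nat.le_of_dvd hb0 ((ZMod.natCast_eq_zero_iff b L).1 (add_eq_left.mp h))) (by omega))]
  by_cases hC : ∀ a < L, ∀ b < L, m ![i + a, j + b] = m ![i, j]
  swap
  · rw [if_neg hC, if_neg hC]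
  rw [if_pos hC, if_pos hC, ZMod.natCast_self, add_zero]
  obtain ⟨L₀, rfl⟩ : ∃ L₀, L = L₀ + 1 := ⟨L - 1, by omega⟩
  have hrow : ∀ V : GaugeConfig 2 (L₀ + 1) (Matrix.specialUnitaryGroup (Fin 2) ℂ),
      ((List.range (L₀ + 1)).map fun a : ℕ => V (![i + a, j], 0)).prod =
        V (![i, j], 0) * ((List.range L₀).map fun a : ℕ => V (![i + (a + 1 : ℕ), j], 0)).prod := by
    intro V
    rw [list_prod_range_succ_eq_head_mul, Nat.cast_zero, add_zero]
  simp_rw [hrow]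
  have hT : ∀ (w : GaugeConfig 2 (L₀ + 1) (Matrix.specialUnitaryGroup (Fin 2) ℂ)) g,
      ((List.range L₀).map fun a : ℕ => update w (![i, j], 0) g (![i + (a + 1 : ℕ), j], 0)).prod =
        ((List.range L₀).map fun a : ℕ => w (![i + (a + 1 : ℕ), j], 0)).prod := by
    intro w g
    refine list_prod_map_update_of_ne w _ g _ _ fun k hk h => ?_
    rw [List.mem_range] at hk
    rw [Prod.mk.injEq, vec2_eq_iff] at h
    exact absurd (Nat.le_of_dvd (Nat.succ_pos k) ((ZMod.natCast_eq_zero_iff (k + 1) (L₀ + 1)).1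
      (add_eq_left.mp h.1.1))) (by omega)
  have hPc' : Continuous fun w : GaugeConfig 2 (L₀ + 1) (Matrix.specialUnitaryGroup (Fin 2) ℂ) =>
      w (![i, j], 0) * ((List.range L₀).map fun a : ℕ => w (![i + (a + 1 : ℕ), j], 0)).prod :=
    (continuous_apply _).mul (continuous_list_prod _ fun k _ => continuous_apply _)
  have h := integral_pi_mul_of_update_eq (ι := Edge 2 (L₀ + 1))
    (haarProbability (Matrix.specialUnitaryGroup (Fin 2) ℂ)) (![i, j], 0)
    (fun w => ((List.range L₀).map fun a : ℕ => w (![i + (a + 1 : ℕ), j], 0)).prod) hT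
    (fun g => su2a0 g * su2a0 g * ((U ℝ (m ![i, j])).eval (su2a0 g) * (U ℝ (m ![i, j])).eval (su2a0 g)))
    (integrable_pi_su2_of_continuous (((continuous_su2a0.comp hPc').mul (continuous_su2a0.comp hPc')).mul
      ((continuous_su2Character_comp _ hPc').mul (continuous_su2Character_comp _ hPc'))))
  rw [h, integral_su2a0_sq_mul_su2Character_sq]

/-! ## §3. The exact mean square -/

/-- **`∫ (½tr P_j)² e^{−βS} dHaar^{⊗E} = ¼ Σ_n (1 + [n ≠ 0]) λ_n^{L²}`** (`β ≥ 0`, `λ_n = c_n/(n+1)`), as a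
`HasSum`: only the constant assignments contribute. -/
theorem hasSum_integral_su2a0_sq_polyakov_mul_exp_neg_wilsonAction_two {β : ℝ} (hβ : 0 ≤ β) (i j : ZMod L) :
    HasSum (fun n : ℕ => (1 / 4 : ℝ) * (if n = 0 then 1 else 2) *
        (Real.exp (-(2 * β)) * (besselI n (2 * β) - besselI (n + 2) (2 * β)) / ((n : ℝ) + 1)) ^ (L ^ 2))
      (∫ V, su2a0 (((List.range L).map fun a : ℕ => V (![i + a, j], 0)).prod) *
          su2a0 (((List.range L).map fun a : ℕ => V (![i + a, j], 0)).prod) *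
        Real.exp (-β * wilsonAction (fundamentalRep (Fin 2)) V)
        ∂(Measure.pi fun _ : Edge 2 L => haarProbability (Matrix.specialUnitaryGroup (Fin 2) ℂ))) := by
  haveI := secondCountableTopology_su2
  have hPc := continuous_rowProd (L := L) i j L
  obtain ⟨hsum, hN⟩ := integral_obs_mul_exp_neg_wilsonAction_eq_tsum (L := L) hβ
    (fun V : GaugeConfig 2 L (Matrix.specialUnitaryGroup (Fin 2) ℂ) =>
      su2a0 (((List.range L).map fun a : ℕ => V (![i + (a : ZMod L), j], 0)).prod) *
        su2a0 (((List.range L).map fun a : ℕ => V (![i + (a : ZMod L), j], 0)).prod))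
    ((continuous_su2a0.comp hPc).mul (continuous_su2a0.comp hPc)).measurable
    (fun V => by
      rw [abs_mul]
      exact mul_le_one₀ (abs_su2a0_le_one _) (abs_nonneg _) (abs_su2a0_le_one _))
  set pl : {p : Fin 2 × Fin 2 // p.1 < p.2} := ⟨((0 : Fin 2), (1 : Fin 2)), by decide⟩ with hpl
  set p₀ : Plaquette 2 L := (![i, j], pl) with hp₀
  set c : ℕ → ℝ := fun n => Real.exp (-(2 * β)) * (besselI n (2 * β) - besselI (n + 2) (2 * β)) with hc
  have hc0 : ∀ n, 0 ≤ c n := fun n => charCoeff_nonneg hβ n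
  set Tc : (Plaquette 2 L → ℕ) → ℝ := fun x => (∏ p, c (x p)) *
    (if (∀ a < L, ∀ b < L, x (![i + a, j + b], pl) = x p₀) then
      ((((x p₀ : ℝ) + 1) ^ (L * L)))⁻¹ * ((1 / 4) * (if x p₀ = 0 then 1 else 2))
     else 0) with hTc
  have hT : ∀ x : Plaquette 2 L → ℕ,
      (∏ p, Real.exp (-(2 * β)) * (besselI (x p) (2 * β) - besselI (x p + 2) (2 * β))) *
      ∫ V, su2a0 (((List.range L).map fun a : ℕ => V (![i + (a : ZMod L), j], 0)).prod) *
          su2a0 (((List.range L).map fun a : ℕ => V (![i + (a : ZMod L), j], 0)).prod) *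
        ∏ p : Plaquette 2 L, (U ℝ (x p)).eval (su2a0 (plaquetteHolonomy V p.1 p.2.1.1 p.2.1.2))
        ∂(Measure.pi fun _ : Edge 2 L => haarProbability (Matrix.specialUnitaryGroup (Fin 2) ℂ)) = Tc x := by
    intro x
    have hint : (fun V : GaugeConfig 2 L (Matrix.specialUnitaryGroup (Fin 2) ℂ) =>
        su2a0 (((List.range L).map fun a : ℕ => V (![i + (a : ZMod L), j], 0)).prod) *
          su2a0 (((List.range L).map fun a : ℕ => V (![i + (a : ZMod L), j], 0)).prod) *
        ∏ p : Plaquette 2 L, (U ℝ (x p)).eval (su2a0 (plaquetteHolonomy V p.1 p.2.1.1 p.2.1.2))) =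
        fun V => su2a0 (((List.range L).map fun a : ℕ => V (![i + (a : ZMod L), j], 0)).prod) *
          su2a0 (((List.range L).map fun a : ℕ => V (![i + (a : ZMod L), j], 0)).prod) *
          ∏ s : Site 2 L, (U ℝ ((fun s : Site 2 L => x (s, pl)) s)).eval (su2a0 (plaquetteHolonomy V s 0 1)) := by
      funext V
      rw [prod_plaquette_two]
    rw [hint, integral_su2a0_sq_polyakov_mul_prod_su2Character i j, hTc, hc]
  simp_rw [hT] at hsum hN
  -- the surviving assignments are the constants
  set g : ℕ → (Plaquette 2 L → ℕ) := fun n _ => n with hg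
  have hginj : Injective g := fun n n' h => by simpa [hg] using congrFun h p₀
  have hsupp : support Tc ⊆ Set.range g := by
    intro x hx
    rw [mem_support, hTc] at hx
    simp only at hx
    have hC : ∀ a < L, ∀ b < L, x (![i + a, j + b], pl) = x p₀ := by
      by_contra h; rw [if_neg h, mul_zero] at hx; exact hx rfl
    refine ⟨x p₀, funext fun p => ?_⟩
    rw [plaquette_two_eq p, hg]
    have hp : p.1 ∈ (range L ×ˢ range L).image (fun q : ℕ × ℕ => (![i + q.1, j + q.2] : Site 2 L)) := by
      rw [rect_eq_univ]; exact Finset.mem_univ _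
    obtain ⟨q, hq, hq1⟩ := Finset.mem_image.mp hp
    rw [Finset.mem_product, Finset.mem_range, Finset.mem_range] at hq
    rw [← hq1]
    exact (hC q.1 hq.1 q.2 hq.2).symm
  have hcardP : Fintype.card (Plaquette 2 L) = L * L := by
    rw [← sq, ← Flux.card_site_two (L := L)]
    exact Fintype.card_congr ⟨fun p => p.1, fun s => (s, pl), fun p => (plaquette_two_eq p).symm,
      fun _ => rfl⟩
  have hTg : ∀ n : ℕ, Tc (g n) = (1 / 4 : ℝ) * (if n = 0 then 1 else 2) * (c n / ((n : ℝ) + 1)) ^ (L ^ 2) := by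
    intro n
    rw [hTc]
    simp only [hg]
    rw [if_pos (fun _ _ _ _ => trivial), Finset.prod_const, Finset.card_univ, hcardP, div_pow, sq L]
    ring
  have h1 : HasSum (Tc ∘ g) (∑' x, Tc x) := by
    rw [← hginj.tsum_eq hsupp]
    exact (hsum.comp_injective hginj).hasSum
  rw [← hN] at h1
  refine h1.congr_fun fun n => ?_
  simp only [Function.comp_apply, hTg, hc]

/-- **THE EXACT MEAN SQUARE OF THE SU(2) POLYAKOV LOOP ON THE 2-TORUS.**  For every `L ≥ 1`, `β ≥ 0` and
base point `(i,j)`, under theory-2's Wilson measure on `(ℤ/L)²`: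
`⟨(½ tr P_j)²⟩ = ¼ Σ_n (1 + [n ≠ 0]) λ_n^{L²} / Σ_n λ_n^{L²}` (`λ_n = c_n/(n+1)`), i.e. `½ − λ_0^{L²}/(4Z)`:
the `R = 0` entry of oracle X02's `polyakov_2pt`. -/
theorem wilson_mean_su2a0_sq_polyakov_two {β : ℝ} (hβ : 0 ≤ β) (i j : ZMod L) :
    ∫ V, su2a0 (((List.range L).map fun a : ℕ => V (![i + a, j], 0)).prod) *
          su2a0 (((List.range L).map fun a : ℕ => V (![i + a, j], 0)).prod)
        ∂(wilsonMeasure (d := 2) (L := L) (fundamentalRep (Fin 2)) β) =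
      (∑' n : ℕ, (1 / 4 : ℝ) * (if n = 0 then 1 else 2) *
        (Real.exp (-(2 * β)) * (besselI n (2 * β) - besselI (n + 2) (2 * β)) / ((n : ℝ) + 1)) ^ (L ^ 2)) /
      ∑' n : ℕ, (Real.exp (-(2 * β)) * (besselI n (2 * β) - besselI (n + 2) (2 * β)) /
        ((n : ℝ) + 1)) ^ (L ^ 2) := by
  rw [integral_wilsonMeasure_su2_eq_div,
    ← (hasSum_integral_su2a0_sq_polyakov_mul_exp_neg_wilsonAction_two hβ i j).tsum_eq,
    partitionFunction_su2_two_toReal_eq_tsum hβ]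

end Summit.Ventures.LatticeQCDFlow.Scoring
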